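import Summits.RiemannHypothesis.RiemannHypothesis.Theorems.TiltedLandingLaw421R3TouchedDissipation

/-!
# T⁗ — the FRAME-WEIGHTED log-profile dissipation SOCKET `TouchedDissipationLawWQ cF L κ₀` and its instance `TouchedDissipationLawTQ c L κ₀ θ`
(lens-2 g7; TYPED per (CA680)(D2) after CUT 34; memo `lens2/TQ-FRAMEWISE-MEMO-v1.md` ad1b401b, decldiff `lens2/GLUE-V5-DECLDIFF-v1.md` f8dc3f57; a LAW, unproved)
ONE tree import (C′ module `…R3TouchedDissipation`, #1178).  Self-contained: the log weight `logWeight` of the dead T‴ draft (`lens2/TouchedDissipationL-v1.lean`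
64d6c277, never landed) is re-homed here (§1).  PARAMETERS: `c` (dissipation constant), `L` (log slope), `κ₀` (field floor) — binders; `θ` (weight slope) a
binder of the general instance, with the value of record `thetaW = 2` a binder-free def (§1, justified there); NOTHING ELSE BAKED.
STATEMENT.  Same population as C′/T‴ (legal frame; CHARGED APPROACH level `j`; lowest band state `v` touched by a strictly taller zero `z` of `f⁽ʲ⁾`; the
pair atomic; `κ₀ ≤ Im v·κ_v`); with `e := Im v² + Im z²`, `y(e) := 1 + L·log(2Hs²/e)`:   `cF(F)·s² ≤ η²·y(e)²·(e − childEnergy Ū)`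
— T‴'s inequality VERBATIM with the global constant `c` replaced by a FRAME FUNCTIONAL `cF : Budget` (a function of the datum `(η,f,x₀,s,hmax,R,Hs,B)`
only, like every budget of the books).  [Erratum to the decldiff's one-liner, which put `y²` on the left: the benches' merit is `M_row(L) = X″·y²`, so `y²`
multiplies `ΔE`, as in T‴ and in the glue's paying inequality.]  T⁗ = the instance `cF := c / w_F`, `w_F := max(1, θ·(B+1)·(s/Hs)²)` (`frameWeightQ`):
big-`B` frames (one-sided fences, towers: B ≈ 60–110·(Hs/s)²) get the SMALL constant; balanced frames (`w_F = 1`) must carry `c` itself.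
BENCH OF RECORD (crit-1 CUT 34, (CA680), floats): decision number min over LEGAL ∧ CHARGED rows of `M_row(L)·w_F/need(.66, L)` = ×4.2 (row «W2F», L = 0)
among balanced frames, ≥ ×30 among one-sided frames; my predicted killer «W2F-tall» was neither legal nor charged; next adversary named: «W2F-sparse» (l.8232).
KILL: a legal charged atomic approach β-row with `X″·y_L(u)²·w_F < c` at the instance under test.
Nothing here bears on the truth of RH; RH is not proved; T⁗ is a typed LAW (OPEN), it survived ONE cut as a candidate; T″/T‴ dead; C′ typed not proved;
★A / 33346 / 33347 OPEN; checked ≠ landed ≠ proved. -/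

namespace RhW08.TouchedDissipationW

open Complex
open scoped ComplexConjugate
open RhW08.Round1 RhW08.StSwap RhW08.Round2 RhW08.QuadW
open RhW08.SealSwap (PBot)
open RhW08.SealSwapQ RhW08.RateSplit RhW08.BurgersRate RhW08.BurgersRateG3 RhW08.TouchedDissipation
open RhIdea6.G17.W07C7 RhIdea6.G17.W07C7.Rev6 RhIdea6.G18.W07C8.Law421BirthS RhIdea6.G19.W07C11.Seam
open RhIdea6.G20.W07C12.Frac RhIdea6.G20.W07C12.StColP RhW07.C12.FieldSplit RhIdea6.G21.W07C13.TentMax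
open RhW07.C14.TwoSided RhW07.C14.Classes RhW07.C14.Lineage RhW07.C14.Booking

/-! ## §1 Weights -/

/-- §1 the LOG-PROFILE WEIGHT `y(E) = 1 + L·log(2Hs²/E)` of an energy `E` in a strip of height `Hs` (`= 1` at `E = 2Hs²`; Lean junk: `E = 0 ⇒ y = 1`). -/
noncomputable def logWeight (L Hs E : ℝ) : ℝ := 1 + L * Real.log (2 * Hs ^ 2 / E)

/-- §1 the FRAME WEIGHT `w_F := max(1, θ·(B+1)·(s/Hs)²)` — a `Budget` (function of the frame datum only); `≥ 1`; reads `1` whenever `θ·(B+1) ≤ (Hs/s)²`. -/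
noncomputable def frameWeightQ (θ : ℝ) : Budget := fun _η _f _x₀ s _hmax _R Hs B => max 1 (θ * ((B : ℝ) + 1) * (s / Hs) ^ 2)

/-- §1 the WEIGHTED CONSTANT `c_F := c / w_F`. -/
noncomputable def weightedConstQ (c θ : ℝ) : Budget := fun η f x₀ s hmax R Hs B => c / frameWeightQ θ η f x₀ s hmax R Hs B

/-- §1 the weight slope OF RECORD `θ_W := 2` (binder-free).  WHY THIS VALUE, and why it is not a hand-picked truth threshold (checklist 4c(iv)): the law
`TouchedDissipationLawTQ c L κ₀ θ` is WEAKER for LARGER `θ` (`lawTQ_mono_theta`), so `θ` is capped only by what the BOOKS can pay: FIT_W's B-bracket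
(`approachBudgetHalfQ` carries `(3/2)·(B+1)` of capital per frame, `approachBudgetHalf_apply`) reads `φ₀·θ ≤ 3/2` with `φ₀ = (1+2L+2L²)/(2c)`, i.e.
`θ ≤ 3/(2φ₀) ∈ [2, 2.5]` on the purse factors of record `φ₀ ∈ [0.6, 0.75]`; `2` is the largest value payable across that whole range.  Any other `θ` is
another INSTANCE of the socket, not an edit of this file. -/
def thetaW : ℝ := 2

/-! ## §2 The socket and the law (parameters only; nothing instantiated numerically except `thetaW`) -/

/-- (SOCKET W — FRAME-WEIGHTED LOG-PROFILE DISSIPATION ON TOUCHED APPROACH LEVELS; typed, OPEN) for a frame functional `cF`: on a legal frame, at a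
CHARGED APPROACH level `j` whose lowest band state `v` is touched by a strictly taller zero `z` of `f⁽ʲ⁾` (`Touches`), the pair atomic (`AtomicPair`),
the state field above the floor (`κ₀ ≤ Im v·κ_v`): `cF(F)·s² ≤ η²·(1 + L·log(2Hs²/(Im v² + Im z²)))²·((Im v² + Im z²) − childEnergy(Ū))`. -/
def TouchedDissipationLawWQ (cF : Budget) (L κ₀ : ℝ) : Prop :=
  ∀ (η : ℝ) (f : ℂ → ℂ) (x₀ s hmax R Hs : ℝ) (B : ℕ), EngineHyps5 2 η f x₀ s hmax R Hs B →
    ∀ (j : ℕ) (v z : ℂ), Charged (PTrkSQ PBot) StTrkDQ ReadyR2 η f x₀ s hmax R Hs B j → ApproachLevelQ η f x₀ s hmax R Hs B j →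
      IsLowest StTrkDQ η f x₀ s hmax R Hs B j v → Touches f j v z → AtomicPair f j v z →
      κ₀ ≤ v.im * stateKappa f j v →
      cF η f x₀ s hmax R Hs B * s ^ 2
        ≤ η ^ 2 * logWeight L Hs (v.im ^ 2 + z.im ^ 2) ^ 2 * ((v.im ^ 2 + z.im ^ 2) - childEnergy f j (pairUnion v z))

/-- (LAW T⁗(c, L, κ₀, θ) — typed, OPEN) the socket at the weighted constant `c / max(1, θ·(B+1)·(s/Hs)²)`. -/
def TouchedDissipationLawTQ (c L κ₀ θ : ℝ) : Prop := TouchedDissipationLawWQ (weightedConstQ c θ) L κ₀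

/-- (LAW T⁗ OF RECORD — `θ = thetaW = 2`; `c, L, κ₀` parameters) -/
def TouchedDissipationLawTWQ (c L κ₀ : ℝ) : Prop := TouchedDissipationLawTQ c L κ₀ thetaW

/-! ## §3 Bookkeeping (K) -/

/-- (K) `y(2Hs²) = 1` (also for `Hs = 0`). -/
theorem logWeight_top (L Hs : ℝ) : logWeight L Hs (2 * Hs ^ 2) = 1 := by
  unfold logWeight
  by_cases h : 2 * Hs ^ 2 = 0
  · rw [h]; simp
  · rw [div_self h, Real.log_one]; ring

/-- (K) `1 ≤ y(E)` for `0 ≤ L`, `0 < E ≤ 2Hs²`. -/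
theorem one_le_logWeight {L Hs E : ℝ} (hL : 0 ≤ L) (hE : 0 < E) (hEA : E ≤ 2 * Hs ^ 2) : 1 ≤ logWeight L Hs E := by
  unfold logWeight
  have hlog : 0 ≤ Real.log (2 * Hs ^ 2 / E) := Real.log_nonneg ((one_le_div hE).2 hEA)
  nlinarith

/-- (K) `1 ≤ w_F`, hence `0 < w_F`. -/
theorem one_le_frameWeightQ (θ η : ℝ) (f : ℂ → ℂ) (x₀ s hmax R Hs : ℝ) (B : ℕ) : 1 ≤ frameWeightQ θ η f x₀ s hmax R Hs B :=
  le_max_left _ _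

/-- (K) the frame weight is positive. -/
theorem frameWeightQ_pos (θ η : ℝ) (f : ℂ → ℂ) (x₀ s hmax R Hs : ℝ) (B : ℕ) : 0 < frameWeightQ θ η f x₀ s hmax R Hs B :=
  one_pos.trans_le (one_le_frameWeightQ θ η f x₀ s hmax R Hs B)

/-- (K) `w_F ≤ 1 + θ·(B+1)·(s/Hs)²` for `0 ≤ θ` (the form FIT_W's two brackets use). -/
theorem frameWeightQ_le {θ : ℝ} (hθ : 0 ≤ θ) (η : ℝ) (f : ℂ → ℂ) (x₀ s hmax R Hs : ℝ) (B : ℕ) :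
    frameWeightQ θ η f x₀ s hmax R Hs B ≤ 1 + θ * ((B : ℝ) + 1) * (s / Hs) ^ 2 := by
  have h0 : 0 ≤ θ * ((B : ℝ) + 1) * (s / Hs) ^ 2 := by positivity
  exact max_le (by linarith) (by linarith)

/-- (K) `w_F` is monotone in `θ`. -/
theorem frameWeightQ_mono {θ θ' : ℝ} (hθ : θ ≤ θ') (η : ℝ) (f : ℂ → ℂ) (x₀ s hmax R Hs : ℝ) (B : ℕ) :
    frameWeightQ θ η f x₀ s hmax R Hs B ≤ frameWeightQ θ' η f x₀ s hmax R Hs B :=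
  max_le_max le_rfl (mul_le_mul_of_nonneg_right (mul_le_mul_of_nonneg_right hθ (by positivity)) (sq_nonneg _))

/-- (K) `0 < c ⇒ 0 < c_F`, and `0 ≤ c ⇒ c_F ≤ c`. -/
theorem weightedConstQ_pos {c : ℝ} (hc : 0 < c) (θ η : ℝ) (f : ℂ → ℂ) (x₀ s hmax R Hs : ℝ) (B : ℕ) :
    0 < weightedConstQ c θ η f x₀ s hmax R Hs B :=
  div_pos hc (frameWeightQ_pos θ η f x₀ s hmax R Hs B)

/-- (K) the weighted constant never exceeds `c` (the weight is `≥ 1`). -/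
theorem weightedConstQ_le {c : ℝ} (hc : 0 ≤ c) (θ η : ℝ) (f : ℂ → ℂ) (x₀ s hmax R Hs : ℝ) (B : ℕ) :
    weightedConstQ c θ η f x₀ s hmax R Hs B ≤ c :=
  div_le_self hc (one_le_frameWeightQ θ η f x₀ s hmax R Hs B)

/-- (K) the socket is DOWNWARD-closed in the frame functional (pointwise on legal frames) and UPWARD-closed in the floor. -/
theorem lawWQ_mono {cF cF' : Budget} {L κ₀ κ₀' : ℝ}
    (hc : ∀ (η : ℝ) (f : ℂ → ℂ) (x₀ s hmax R Hs : ℝ) (B : ℕ), EngineHyps5 2 η f x₀ s hmax R Hs B →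
      cF' η f x₀ s hmax R Hs B ≤ cF η f x₀ s hmax R Hs B)
    (hκ : κ₀ ≤ κ₀') (h : TouchedDissipationLawWQ cF L κ₀) : TouchedDissipationLawWQ cF' L κ₀' :=
  fun η f x₀ s hmax R Hs B hE j v z hch hA hlow ht ha hfl =>
    (mul_le_mul_of_nonneg_right (hc η f x₀ s hmax R Hs B hE) (sq_nonneg s)).trans
      (h η f x₀ s hmax R Hs B hE j v z hch hA hlow ht ha (hκ.trans hfl))

/-- (K) a FRAME-BLIND constant implies the weighted law: `W(const c) → T⁗(c, θ)` for `0 ≤ c` (T‴, were it true, would give T⁗ — sanity only; T‴ is dead). -/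
theorem lawTQ_of_const {c L κ₀ : ℝ} (hc : 0 ≤ c) (θ : ℝ) (h : TouchedDissipationLawWQ (fun _ _ _ _ _ _ _ _ => c) L κ₀) :
    TouchedDissipationLawTQ c L κ₀ θ :=
  lawWQ_mono (fun η f x₀ s hmax R Hs B _ => weightedConstQ_le hc θ η f x₀ s hmax R Hs B) le_rfl h

/-- (K) T⁗ is DOWNWARD-closed in `c`, UPWARD-closed in `κ₀` and in `θ` (larger weight slope = weaker law), for `0 ≤ c'`. -/
theorem lawTQ_mono_theta {c c' L κ₀ κ₀' θ θ' : ℝ} (hc' : 0 ≤ c') (hcc : c' ≤ c) (hκ : κ₀ ≤ κ₀') (hθ : θ ≤ θ')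
    (h : TouchedDissipationLawTQ c L κ₀ θ) : TouchedDissipationLawTQ c' L κ₀' θ' := by
  refine lawWQ_mono (fun η f x₀ s hmax R Hs B _ => ?_) hκ h
  have hw := frameWeightQ_pos θ η f x₀ s hmax R Hs B
  calc weightedConstQ c' θ' η f x₀ s hmax R Hs B ≤ c' / frameWeightQ θ η f x₀ s hmax R Hs B :=
        div_le_div_of_nonneg_left hc' hw (frameWeightQ_mono hθ η f x₀ s hmax R Hs B)
    _ ≤ weightedConstQ c θ η f x₀ s hmax R Hs B := div_le_div_of_nonneg_right hcc hw.le

/-- (K) on a row of the socket with `0 < cF(F)` the energy drop is NON-NEGATIVE (the weight is squared). -/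
theorem drop_nonneg_of_lawWQ {cF : Budget} {L κ₀ : ℝ} (h : TouchedDissipationLawWQ cF L κ₀)
    {η : ℝ} {f : ℂ → ℂ} {x₀ s hmax R Hs : ℝ} {B : ℕ} (hE : EngineHyps5 2 η f x₀ s hmax R Hs B) (hcF : 0 < cF η f x₀ s hmax R Hs B)
    {j : ℕ} {v z : ℂ} (hch : Charged (PTrkSQ PBot) StTrkDQ ReadyR2 η f x₀ s hmax R Hs B j) (hA : ApproachLevelQ η f x₀ s hmax R Hs B j)
    (hlow : IsLowest StTrkDQ η f x₀ s hmax R Hs B j v) (ht : Touches f j v z) (ha : AtomicPair f j v z) (hfl : κ₀ ≤ v.im * stateKappa f j v) :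
    0 ≤ (v.im ^ 2 + z.im ^ 2) - childEnergy f j (pairUnion v z) := by
  have hs : 0 < s := hE.2.2.2.1
  have hrow := h η f x₀ s hmax R Hs B hE j v z hch hA hlow ht ha hfl
  by_contra hneg
  push Not at hneg
  have h0 : η ^ 2 * logWeight L Hs (v.im ^ 2 + z.im ^ 2) ^ 2 * ((v.im ^ 2 + z.im ^ 2) - childEnergy f j (pairUnion v z)) ≤ 0 :=
    mul_nonpos_of_nonneg_of_nonpos (by positivity) hneg.le
  nlinarith [mul_pos hcF (pow_pos hs 2)]

/-- (K) the weighted purse identity FIT_W reads: `1/c_F = w_F/c`. -/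
theorem inv_weightedConstQ (c θ η : ℝ) (f : ℂ → ℂ) (x₀ s hmax R Hs : ℝ) (B : ℕ) :
    1 / weightedConstQ c θ η f x₀ s hmax R Hs B = frameWeightQ θ η f x₀ s hmax R Hs B / c := by
  unfold weightedConstQ
  rw [one_div, inv_div]

end RhW08.TouchedDissipationW


/-! # TiltedLandingLaw421R3TouchedDissipationWInstance — the INSTANCE OF RECORD `T⁗★` of the frame-weighted touched-pair dissipation law (lens-2 g7)

ONE import: module 1 `…R3TouchedDissipationW` (RSV-40: the constant-free SOCKET `TouchedDissipationLawWQ`, the weight `frameWeightQ θ` over the TREE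
budget `B`, `TouchedDissipationLawTQ c L κ₀ θ`, `thetaW := 2`, monotonicity).  This file adds ONLY the numeric instance chosen AFTER CUT 34 / CUT 35
((CA690)(C), (CA692)(A): «ONE added Instance file, never an edit of 40/41»), its admissibility lemma and the downward transport.  The numbers in the
docstrings are bench floats / certificates of record (crit-1 CUT 34 + its CORRECTION «W2F-high» l.8268, two-handed engine; instr-1 (T10′); C6 CUT 35 scout) — NOT proofs; instr-1 g8's E3
(weighted FIT minimum over the 666-row census with tree-currency `B`) is the remaining cheap falsifier of exactly this instance and its number will be
quoted here when published (a re-fit is another instance, transported by `lawTQ_of_lawTStar` / `lawTQ_mono_theta`, never an edit of module 1 or 2).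
RETOUCH-COUNT EXPOSURE ((CA681)(D)/(CA692)(A) — named HERE because module 2's §G1/§G2 only cite the price note): Γ3′ `TouchRiseLawWQ cF L κ₀ aT` makes
`aT F` absorb `Σ_k RTB_k` over EVERY charged retouch of the tracked lineage in the frame; the number `k` of charged full-band retouches is bounded by
nothing typed (a priori only by the number of levels, `≲ B + 1 + D_g`), and one such retouch costs ≈ `ρ²η²u_new·(Hs/s)²/X ≈ 0.18·(Hs/s)²`
(`lens2/RETOUCH-PRICE-NOTE-v1.md`; instr-1: 0.183 P).  At T⁗★ the P-bracket spare is ≈ 0.17·(Hs/s)², so FIT_W at this instance PRESUMES `k ≤ 1` charged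
full-band retouch per lineage unless the retouches are B-funded (tall storeys ⇒ large tree `B` ⇒ the `(3/2)(B+1)` capital pays); crit-1's RETOUCH LADDER
(k = 2, 3 successively taller anti-aligned storeys) decides: `k_realised ≥ 3` charged on one lineage with the total above the allowance re-opens the fit
(then `c ↓` — member margin ×1.9 at c = 2, ×1.56 at 1.6 — or `aT` B-funded, or L ↑), `k ≤ 1` structurally closes it.
Nothing here bears on the truth of RH; RH is not proved; T⁗★ is a TYPED, UNPROVED law; Γ3′ / Γ4 / FIT debits unpriced; C′ typed not proved; ★A / 33346 /
33347 OPEN; checked ≠ landed ≠ proved. -/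

namespace RhW08.TouchedDissipationWStar

open RhW08.TouchedDissipationW

/-- (LAW T⁗★ — THE INSTANCE OF RECORD) `T⁗(c = 2, L = 7/20, κ₀ = 3, θ = thetaW = 2)`.  MARGIN TABLE (need `M_row(0.35)·w_F ≥ 2`, where
`M_row(L) = X″·(1 + L·log(2/u))²`, `w_F = max(1, 2(B+1)(s/Hs)²)`, `B` in TREE currency; MEMBERSHIP = the typed `Charged` incl. `SuccOf (1/4)`: a level
is un-charged as soon as some level-1 state sits `≥ s/4` below the lowest state — crit-1 CUT 34 CORRECTION l.8268).  BALANCED MEMBERS («W2F-high»: u023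
fence + two-sided sea RAISED to height h, F = −46, hole AtomicPair-minimal; `w_F = 1` on every balanced row since `(B+1)/(Hs/s)² ≤ 1/4`; floats, two-handed
engine, certificate of the binding member pending in `crit-g5/cut35/`): h = .16 ×2.69 · .20 ×2.41 · .25 ×2.13 · **.30 ×1.95 (X″ 1.257, u 0.2267, M(.35) =
3.90; at F = −49.9, R ≥ 5400: ×1.88)** · .50 ×2.20 · 1.0 ×2.53 · 1.1 ×2.58 · 1.5 ×2.77; h ≤ .14 (incl. the former «W2F of record» h = .12, X″ 1.97) are
NON-MEMBERS (the sea's pull drags v's child past `s/4` ⇒ `SuccOf`), h ≥ 1.7 are READY (deficit-tail NL event) ⇒ **MINIMUM MARGIN OF RECORD ≈ ×1.9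
(floats) on the member h = .30** — not the ×3.06 of my l.8260 (computed on a non-member; withdrawn).  Other L on that member at c = 2: L = .25 ×1.50 ·
.43 ×2.36 · .60 ×3.34 (L ↑ helps the LAW side on balanced members; the FIT side pays `φ₀ = (1+2L+2L²)/(2c)`).  ONE-SIDED rows need the weight and have
it: rowR_u023 (X″ 0.4785 cert, M(.35) = 1.48; B ≥ 11 733 at R = 120 ⇒ w_F ≥ 26 ⇒ ×19); instr-1's R-free census rows (m(.35) ≈ 1.0–1.3 unweighted;
B ≈ 60–110·(Hs/s)² ⇒ w_F ≥ 120 ⇒ × ≥ 60; exact weighted minimum = instr-1 g8 E3, pending); unweighted already-passing: WFence8 / WCan4 ×1.15, F-tower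
K = 3 ×1.79, top-strip two-pair rows ×1.5, C′'s certified low row (X″ 2.89) ≥ ×1.45.  PESSIMISTIC reading (w_F := 1 everywhere): u023 ×0.74 and the
R-free rows ≈ ×0.5 FAIL — the weight is load-bearing on one-sided frames BY DESIGN (that is what killed T‴).  WHY (2, 0.35) is kept after the
correction: ×1.9 on the binding member with `φ₀★ = 389/800 ≈ 0.486` (P-bracket spare ≈ 0.17·(Hs/s)², B-bracket `φ₀★·θ = 0.97 ≤ 3/2` ⇒ 0.53·(B+1) spare);
the alternatives trade law margin for purse: (2, .43) ×2.36 but φ₀ = 0.557 (spare 0.10 < one retouch 0.18), (1.6, .35) ×1.56 with spare 0.05 more.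
RE-FIT TRIGGERS (each = ONE new instance line, proofs transported by `lawTQ_of_lawTStar` / `lawTQ_mono_theta` where the direction allows): certified
member margin < ×1.5 ⇒ L → .43; E3 weighted minimum < 2 on some one-sided row ⇒ θ or c moves; RETOUCH LADDER k ≥ 2 charged per lineage ⇒ c ↓ or aT
B-funded. -/
def TouchedDissipationLawTStarQ : Prop := TouchedDissipationLawTQ 2 (7 / 20) 3 thetaW

/-- (K) the instance constants are admissible and the purse factor is `φ₀★ = 389/800`. -/
theorem lawTStar_consts :
    (0 : ℝ) < 2 ∧ (0 : ℝ) ≤ 7 / 20 ∧ (0 : ℝ) < 3 ∧ (0 : ℝ) ≤ thetaW ∧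
      (1 + 2 * (7 / 20 : ℝ) + 2 * (7 / 20) ^ 2) / (2 * 2) = 389 / 800 := by
  unfold thetaW; norm_num

/-- (K) T⁗★ transports to every weaker instance: `0 ≤ c ≤ 2`, `3 ≤ κ₀`, `thetaW ≤ θ`, same `L = 7/20`. -/
theorem lawTQ_of_lawTStar {c κ₀ θ : ℝ} (hc0 : 0 ≤ c) (hc : c ≤ 2) (hκ : 3 ≤ κ₀) (hθ : thetaW ≤ θ)
    (h : TouchedDissipationLawTStarQ) : TouchedDissipationLawTQ c (7 / 20) κ₀ θ :=
  lawTQ_mono_theta hc0 hc hκ hθ h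

/-- (K) in particular T⁗★ gives the `thetaW`-instance `TouchedDissipationLawTWQ c (7/20) κ₀` for every `0 ≤ c ≤ 2`, `3 ≤ κ₀`. -/
theorem lawTWQ_of_lawTStar {c κ₀ : ℝ} (hc0 : 0 ≤ c) (hc : c ≤ 2) (hκ : 3 ≤ κ₀) (h : TouchedDissipationLawTStarQ) :
    TouchedDissipationLawTWQ c (7 / 20) κ₀ :=
  lawTQ_of_lawTStar hc0 hc hκ le_rfl h

end RhW08.TouchedDissipationWStar
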